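import Literature.NumberTheory.LFunctions.WeilMellinInversion
import Literature.NumberTheory.LFunctions.WeilMellinBounds
import Summits.RiemannHypothesis.RiemannHypothesis.Theorems.WindowTraceArch.Negative.BoundedDensity
import Mathlib.Analysis.Distribution.SchwartzSpace.Deriv
import Mathlib.MeasureTheory.Integral.IntegralEqImproper
import HarnessLib

/-!
# Exact synthesis by the integer crossings (`stub_traceAssembly`)

Route `RiemannHypothesis/SpectralTrace`, crux `WindowStep` (stmt-RiemannHypothesis-14659,
`∀ n ≥ 2, Trace(log n) → Trace(log (n+1))`), line `floor-feedback` (skeleton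
`Summit.RiemannHypothesis.RiemannHypothesis.Cruxes.WindowStep.FloorFeedback`, composition
`WindowStep_of`), stub K2c `stub_traceAssembly`: the glue `K2a → K2b → K2⁺`.

**What is proved.** Assume the band-exclusion identity K2a (for a Weil test `g` supported in
`[-A, A]`, a real Schwartz `k` with `𝓕k ≡ 1` on `|w| ≤ A/2π` and a bounded measurable `b`:
`∫ ĝ(1/2+iT) (k ⋆ b)(T) dT = ∫ ĝ(1/2+iT) b(T) dT`) and the crossing-sum identity K2b (for a
continuous `G` with monotone integer part, `G → ±∞`, `|G| ≤ L(1+T²)`, and `F` with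
`F, F′ = O((1+T²)⁻²)`: `Σ_j F(γ_j) = −∫ F′⌊G⌋` over the first crossings `γ_j = inf {T : j ≤ G(T)}`).
Then for a window density `ρ` at level `A > 0` (`∫ ĝ(1/2+iT) ρ(T) dT = W(g)` for the Weil tests
`g` supported in `[-A, A]`) with primitive `Φ`, `ρ = O(log)`, a kernel `k` with `𝓕k ≡ 1` on the
band, and a continuous solution `h` of the floor–feedback equation `h = k ⋆ fract(Φ + h)` with
`⌊Φ + h⌋` monotone and `Φ + h → ±∞`, the first crossings `γ_j = inf {T : j ≤ Φ(T) + h(T)}`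
(`j ∈ ℤ`) reproduce the Weil functional: `HasSum_j ĝ(1/2 + iγ_j) = W(g)` for every such `g`.

**Proof.** Fix `g`; put `F(T) = ĝ(1/2+iT)` and `F′(T) = i·(t g)^(1/2+iT)`
(`hasDerivAt_weilMellin_line`; `t ↦ t g(t)` is a Weil test, `isWeilTest_mul_id`). Both decay like
`(1+T²)⁻²` (`stub_traceAssembly_decay`: `norm_weilMellin_le` for `g` and `g″` with
`(g″)^(s) = (s−1/2)² ĝ(s)`, `weilMellin_deriv_deriv`); `G = Φ + h` grows at most like `1+T²`
(`|h| ≤ ‖k‖₁`, `stub_traceAssembly_feedback_bound`; `|Φ(T)| ≤ |Φ(0)| + C|T|(1+|T|)` by the mean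
value inequality, `stub_traceAssembly_growth`). K2b gives `HasSum_j F(γ_j) = −∫ F′⌊G⌋`, and
(`stub_traceAssembly_value`) `⌊G⌋ = Φ + h − fract G` with `−∫ F′Φ = ∫ F ρ = W(g)` (integration by
parts on `ℝ`, `integral_mul_deriv_eq_deriv_mul_of_integrable`) and `∫ F′ h = ∫ F′ fract G` (K2a
for the Weil test `t ↦ t g(t)` and `b = fract G`, using `h = k ⋆ fract G`).

References: A. P. Guinand, *A summation formula in the theory of prime numbers*, Proc. London
Math. Soc. (2) 50 (1948) (explicit formula as a summation formula over the zeros);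
E. Bombieri, *Remarks on Weil's quadratic functional in the theory of prime numbers I*, Rend.
Mat. Acc. Lincei (9) 11 (2000), Thm 2.
-/

set_option linter.dupNamespace false

noncomputable section

open Complex Filter Set MeasureTheory
open scoped Real Topology BigOperators FourierTransform SchwartzMap

namespace Summit.RiemannHypothesis.RiemannHypothesis.Theorems.SpectralTraceWindowStep

open Literature.NumberTheory.LFunctions
open Summit.RiemannHypothesis.RiemannHypothesis.Theorems.WindowTraceArch.Negative

/-! ## Decay of `ĝ(1/2 + iT)` like `(1 + T²)⁻²` -/

/-- For a Weil test `g`: `‖ĝ(1/2 + iT)‖ ≤ (C_g + C_{g″}) / (1 + T²)²`, from the strip decay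
`‖ĝ(s)‖ ≤ C_g/(1 + (Im s)²)` (`norm_weilMellin_le`) applied to `g` and to `g″`, whose transform
is `(s - 1/2)² ĝ(s)` (`weilMellin_deriv_deriv`), i.e. `-T² ĝ(1/2+iT)` on the critical line.
[folklore] -/
theorem stub_traceAssembly_decay {g : ℝ → ℂ} (hg : IsWeilTest g) (T : ℝ) :
    ‖weilMellin g (1 / 2 + (T : ℂ) * I)‖ ≤
      (weilDecayConst g + weilDecayConst (deriv (deriv g))) / (1 + T ^ 2) ^ 2 := by
  have hpos : 0 < 1 + T ^ 2 := by positivity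
  have hre : (1 / 2 + (T : ℂ) * I).re = 1 / 2 := by simp
  have him : (1 / 2 + (T : ℂ) * I).im = T := by simp
  have h0 := norm_weilMellin_le hg (s := 1 / 2 + (T : ℂ) * I) (by rw [hre]; norm_num)
    (by rw [hre]; norm_num)
  have h2 := norm_weilMellin_le hg.deriv.deriv (s := 1 / 2 + (T : ℂ) * I) (by rw [hre]; norm_num)
    (by rw [hre]; norm_num)
  rw [him] at h0 h2
  rw [weilMellin_deriv_deriv hg, norm_mul, norm_pow,
    show (1 / 2 + (T : ℂ) * I - 1 / 2) = (T : ℂ) * I by ring, norm_mul, Complex.norm_I, mul_one,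
    Complex.norm_real, Real.norm_eq_abs, sq_abs] at h2
  rw [le_div_iff₀ hpos] at h0 h2
  rw [le_div_iff₀ (by positivity)]
  have e : ‖weilMellin g (1 / 2 + (T : ℂ) * I)‖ * (1 + T ^ 2) ^ 2 =
      ‖weilMellin g (1 / 2 + (T : ℂ) * I)‖ * (1 + T ^ 2) +
        T ^ 2 * ‖weilMellin g (1 / 2 + (T : ℂ) * I)‖ * (1 + T ^ 2) := by ring
  rw [e]
  exact add_le_add h0 h2

/-- A common decay constant for `F(T) = ĝ(1/2+iT)` and its derivative
`F′(T) = i·(t g)^(1/2+iT)`: both are `≤ C/(1+T²)²` (`stub_traceAssembly_decay` for `g` and for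
the Weil test `t ↦ t g(t)`, `isWeilTest_mul_id`). [folklore] -/
theorem stub_traceAssembly_decay_pair {g : ℝ → ℂ} (hg : IsWeilTest g) :
    ∃ C : ℝ, (∀ T : ℝ, ‖weilMellin g (1 / 2 + (T : ℂ) * I)‖ ≤ C / (1 + T ^ 2) ^ 2) ∧
      ∀ T : ℝ, ‖I * weilMellin (fun t : ℝ => (t : ℂ) * g t) (1 / 2 + (T : ℂ) * I)‖ ≤
        C / (1 + T ^ 2) ^ 2 := by
  have hg₁ : IsWeilTest fun t : ℝ => (t : ℂ) * g t := isWeilTest_mul_id hg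
  refine ⟨(weilDecayConst g + weilDecayConst (deriv (deriv g))) +
      (weilDecayConst (fun t : ℝ => (t : ℂ) * g t) +
        weilDecayConst (deriv (deriv fun t : ℝ => (t : ℂ) * g t))), fun T => ?_, fun T => ?_⟩
  · refine (stub_traceAssembly_decay hg T).trans (div_le_div_of_nonneg_right ?_ (by positivity))
    linarith [weilDecayConst_nonneg (fun t : ℝ => (t : ℂ) * g t),
      weilDecayConst_nonneg (deriv (deriv fun t : ℝ => (t : ℂ) * g t))]
  · rw [norm_mul, Complex.norm_I, one_mul]
    refine (stub_traceAssembly_decay hg₁ T).trans (div_le_div_of_nonneg_right ?_ (by positivity))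
    linarith [weilDecayConst_nonneg g, weilDecayConst_nonneg (deriv (deriv g))]

/-! ## Integrability against polynomially bounded factors -/

/-- If `‖F(T)‖ ≤ C/(1+T²)²` (`F` continuous) and `|φ(T)| ≤ L(1+T²)` (`φ` measurable), then
`T ↦ F(T) φ(T)` is integrable on `ℝ` (dominated by `C L (1+T²)⁻¹`,
`integrable_inv_one_add_sq`). [folklore] -/
theorem stub_traceAssembly_integrable {F : ℝ → ℂ} {φ : ℝ → ℝ} {C L : ℝ} (hF : Continuous F)
    (hφ : Measurable φ) (hFd : ∀ T : ℝ, ‖F T‖ ≤ C / (1 + T ^ 2) ^ 2)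
    (hφg : ∀ T : ℝ, |φ T| ≤ L * (1 + T ^ 2)) :
    Integrable (fun T : ℝ => F T * ((φ T : ℝ) : ℂ)) := by
  refine Integrable.mono' (integrable_inv_one_add_sq.const_mul (C * L))
    (hF.aestronglyMeasurable.mul
      (Complex.continuous_ofReal.measurable.comp hφ).aestronglyMeasurable)
    (Eventually.of_forall fun T => ?_)
  have hpos : 0 < 1 + T ^ 2 := by positivity
  rw [norm_mul, Complex.norm_real, Real.norm_eq_abs]
  calc ‖F T‖ * |φ T| ≤ C / (1 + T ^ 2) ^ 2 * (L * (1 + T ^ 2)) :=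
        mul_le_mul (hFd T) (hφg T) (abs_nonneg _) ((norm_nonneg _).trans (hFd T))
    _ = C * L * (1 + T ^ 2)⁻¹ := by
        field_simp

/-! ## Growth of the count `Φ` and of the feedback `h` -/

/-- If `Φ′ = ρ` with `|ρ(T)| ≤ C log(2+|T|)`, then `|Φ(T)| ≤ L(1+T²)` for some `L`
(mean value inequality on `[0, T]` with `log(2+|t|) ≤ 1+|t|`). [folklore] -/
theorem stub_traceAssembly_growth {Φ ρ : ℝ → ℝ} (hΦ : ∀ T : ℝ, HasDerivAt Φ (ρ T) T)
    (hρ : ∃ C : ℝ, ∀ T : ℝ, |ρ T| ≤ C * Real.log (2 + |T|)) :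
    ∃ L : ℝ, ∀ T : ℝ, |Φ T| ≤ L * (1 + T ^ 2) := by
  obtain ⟨C, hC⟩ := hρ
  have hC0 : 0 ≤ C := by
    have h1 := (abs_nonneg _).trans (hC 0)
    have h2 : 0 < Real.log (2 + |(0 : ℝ)|) := Real.log_pos (by norm_num)
    nlinarith
  refine ⟨|Φ 0| + 2 * C, fun T => ?_⟩
  have hbound : ∀ t ∈ uIcc 0 T, ‖ρ t‖ ≤ C * (1 + |T|) := by
    intro t ht
    rw [Real.norm_eq_abs]
    refine (hC t).trans ?_
    have hlog : Real.log (2 + |t|) ≤ 1 + |t| := by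
      have := Real.log_le_sub_one_of_pos (show 0 < 2 + |t| by positivity)
      linarith
    have ht' : |t| ≤ |T| := by
      rcases mem_uIcc.1 ht with ⟨h0, h1⟩ | ⟨h0, h1⟩
      · rw [abs_of_nonneg h0, abs_of_nonneg (h0.trans h1)]
        exact h1
      · rw [abs_of_nonpos h1, abs_of_nonpos (h0.trans h1)]
        linarith
    calc C * Real.log (2 + |t|) ≤ C * (1 + |t|) := mul_le_mul_of_nonneg_left hlog hC0
      _ ≤ C * (1 + |T|) := by gcongr
  have hmvt := Convex.norm_image_sub_le_of_norm_hasDerivWithin_le (f := Φ) (f' := ρ)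
    (s := uIcc 0 T) (fun t _ => (hΦ t).hasDerivWithinAt) hbound (convex_uIcc 0 T) left_mem_uIcc
    right_mem_uIcc
  rw [sub_zero, Real.norm_eq_abs, Real.norm_eq_abs] at hmvt
  have h1 : |Φ T| ≤ |Φ 0| + C * (1 + |T|) * |T| := by
    have := abs_sub_abs_le_abs_sub (Φ T) (Φ 0)
    linarith
  have h3 : (1 + |T|) * |T| ≤ 2 * (1 + T ^ 2) := by
    nlinarith [sq_abs T, abs_nonneg T, sq_nonneg (|T| - 1)]
  have h4 : C * (1 + |T|) * |T| ≤ C * (2 * (1 + T ^ 2)) := by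
    rw [mul_assoc]
    exact mul_le_mul_of_nonneg_left h3 hC0
  nlinarith [abs_nonneg (Φ 0), sq_nonneg T, mul_nonneg (abs_nonneg (Φ 0)) (sq_nonneg T)]

/-- The feedback `h = k ⋆ fract(Φ + h)` is bounded by `‖k‖₁ = ∫ |k|` (`0 ≤ fract < 1` and
translation invariance of Lebesgue measure). [folklore] -/
theorem stub_traceAssembly_feedback_bound (k : 𝓢(ℝ, ℝ)) {Φ h : ℝ → ℝ}
    (hfeed : ∀ T : ℝ, h T = ∫ s : ℝ, k (T - s) * Int.fract (Φ s + h s)) (T : ℝ) :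
    |h T| ≤ ∫ s : ℝ, |k s| := by
  rw [hfeed T]
  refine abs_integral_le_integral_abs.trans ?_
  have hki : Integrable (fun s : ℝ => |k (T - s)|) := (k.integrable.comp_sub_left T).abs
  calc ∫ s, |k (T - s) * Int.fract (Φ s + h s)| ≤ ∫ s, |k (T - s)| := by
        refine integral_mono_of_nonneg (Eventually.of_forall fun s => abs_nonneg _) hki
          (Eventually.of_forall fun s => ?_)
        show |k (T - s) * Int.fract (Φ s + h s)| ≤ |k (T - s)|
        rw [abs_mul]
        refine mul_le_of_le_one_right (abs_nonneg _) ?_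
        rw [abs_of_nonneg (Int.fract_nonneg _)]
        exact (Int.fract_lt_one _).le
    _ = ∫ s, |k s| := integral_sub_left_eq_self (fun s => |k s|) volume T

/-! ## The value of the crossing sum: `-∫ F′⌊Φ + h⌋ = W(g)` -/

/-- **The value of the crossing sum.** With `F(T) = ĝ(1/2+iT)`, `F′(T) = i·(t g)^(1/2+iT)`
(`hasDerivAt_weilMellin_line`): `-∫ F′ ⌊Φ + h⌋ = W(g)`.  Indeed `⌊G⌋ = Φ + h − fract G`, and
`-∫ F′Φ = ∫ F ρ = W(g)` (integration by parts on `ℝ`,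
`integral_mul_deriv_eq_deriv_mul_of_integrable`, and the window-density identity), while
`∫ F′ h = ∫ F′ fract(Φ + h)` is the band-exclusion identity `hex` (the feedback is invisible to
the window). [folklore] -/
theorem stub_traceAssembly_value {Φ ρ h : ℝ → ℝ} {g : ℝ → ℂ} {C LΦ K : ℝ} (hg : IsWeilTest g)
    (hwin : Integrable (fun T : ℝ => weilMellin g (1 / 2 + (T : ℂ) * I) * ((ρ T : ℝ) : ℂ)) ∧
        ∫ T : ℝ, weilMellin g (1 / 2 + (T : ℂ) * I) * ((ρ T : ℝ) : ℂ) = weilFunctional g)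
    (hΦ : ∀ T : ℝ, HasDerivAt Φ (ρ T) T) (hLΦ : ∀ T : ℝ, |Φ T| ≤ LΦ * (1 + T ^ 2))
    (hhc : Continuous h) (hK : ∀ T : ℝ, |h T| ≤ K * (1 + T ^ 2))
    (hex : ∫ T : ℝ, weilMellin (fun t : ℝ => (t : ℂ) * g t) (1 / 2 + (T : ℂ) * I) *
        ((h T : ℝ) : ℂ) =
      ∫ T : ℝ, weilMellin (fun t : ℝ => (t : ℂ) * g t) (1 / 2 + (T : ℂ) * I) *
        ((Int.fract (Φ T + h T) : ℝ) : ℂ))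
    (hFd : ∀ T : ℝ, ‖weilMellin g (1 / 2 + (T : ℂ) * I)‖ ≤ C / (1 + T ^ 2) ^ 2)
    (hF'd : ∀ T : ℝ, ‖I * weilMellin (fun t : ℝ => (t : ℂ) * g t) (1 / 2 + (T : ℂ) * I)‖ ≤
      C / (1 + T ^ 2) ^ 2) :
    -∫ T : ℝ, I * weilMellin (fun t : ℝ => (t : ℂ) * g t) (1 / 2 + (T : ℂ) * I) *
        ((⌊Φ T + h T⌋ : ℝ) : ℂ) = weilFunctional g := by
  set F : ℝ → ℂ := fun T => weilMellin g (1 / 2 + (T : ℂ) * I) with hFdef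
  set F' : ℝ → ℂ := fun T => I * weilMellin (fun t : ℝ => (t : ℂ) * g t) (1 / 2 + (T : ℂ) * I)
    with hF'def
  have hg₁ : IsWeilTest fun t : ℝ => (t : ℂ) * g t := isWeilTest_mul_id hg
  have hFc : Continuous F :=
    (continuous_weilMellin hg.1.continuous hg.2).comp (by fun_prop)
  have hF'c : Continuous F' :=
    continuous_const.mul ((continuous_weilMellin hg₁.1.continuous hg₁.2).comp (by fun_prop))
  have hΦc : Continuous Φ := continuous_iff_continuousAt.2 fun T => (hΦ T).continuousAt
  -- `⌊G⌋ = Φ + h - fract G`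
  have hfl : ∀ T : ℝ, ((⌊Φ T + h T⌋ : ℝ) : ℂ) =
      ((Φ T : ℝ) : ℂ) + ((h T : ℝ) : ℂ) - ((Int.fract (Φ T + h T) : ℝ) : ℂ) := by
    intro T
    rw [← Complex.ofReal_add, ← Complex.ofReal_sub, Int.self_sub_fract]
  -- integrability of the four products
  have i1 : Integrable (fun T : ℝ => F' T * ((Φ T : ℝ) : ℂ)) :=
    stub_traceAssembly_integrable hF'c hΦc.measurable hF'd hLΦ
  have i2 : Integrable (fun T : ℝ => F' T * ((h T : ℝ) : ℂ)) :=
    stub_traceAssembly_integrable hF'c hhc.measurable hF'd hK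
  have i3 : Integrable (fun T : ℝ => F' T * ((Int.fract (Φ T + h T) : ℝ) : ℂ)) := by
    refine stub_traceAssembly_integrable (L := 1) hF'c (hΦc.add hhc).measurable.fract hF'd
      fun T => ?_
    rw [abs_of_nonneg (Int.fract_nonneg _)]
    nlinarith [Int.fract_lt_one (Φ T + h T), sq_nonneg T]
  have i4 : Integrable (fun T : ℝ => F T * ((Φ T : ℝ) : ℂ)) :=
    stub_traceAssembly_integrable hFc hΦc.measurable hFd hLΦ
  -- (i) integration by parts: `∫ F ρ = -∫ F' Φ`
  have parts : ∫ T : ℝ, F T * ((ρ T : ℝ) : ℂ) = -∫ T : ℝ, F' T * ((Φ T : ℝ) : ℂ) :=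
    integral_mul_deriv_eq_deriv_mul_of_integrable (u := F) (u' := F')
      (v := fun T : ℝ => ((Φ T : ℝ) : ℂ)) (v' := fun T : ℝ => ((ρ T : ℝ) : ℂ))
      (fun x _ => hasDerivAt_weilMellin_line hg x) (fun x _ => (hΦ x).ofReal_comp) hwin.1 i1 i4
  have e1 : ∫ T : ℝ, F' T * ((Φ T : ℝ) : ℂ) = -weilFunctional g := by
    rw [← hwin.2, parts, neg_neg]
  -- (ii) band exclusion: `∫ F' h = ∫ F' fract G`
  have e2 : ∫ T : ℝ, F' T * ((h T : ℝ) : ℂ) =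
      ∫ T : ℝ, F' T * ((Int.fract (Φ T + h T) : ℝ) : ℂ) := by
    simp only [hF'def, mul_assoc]
    rw [integral_const_mul, integral_const_mul, hex]
  -- assemble
  have e0 : ∫ T : ℝ, F' T * ((⌊Φ T + h T⌋ : ℝ) : ℂ) =
      ((∫ T : ℝ, F' T * ((Φ T : ℝ) : ℂ)) + ∫ T : ℝ, F' T * ((h T : ℝ) : ℂ)) -
        ∫ T : ℝ, F' T * ((Int.fract (Φ T + h T) : ℝ) : ℂ) := by
    have i12 : Integrable (fun T : ℝ => F' T * ((Φ T : ℝ) : ℂ) + F' T * ((h T : ℝ) : ℂ)) :=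
      i1.add i2
    rw [← integral_add i1 i2, ← integral_sub i12 i3]
    refine integral_congr_ae (Eventually.of_forall fun T => ?_)
    simp only [hfl T]
    ring
  rw [e0, e1, e2]
  ring

/-! ## The stub -/

/-- **K2c · `stub_traceAssembly` — band exclusion and the crossing sum give exact synthesis by the
integer crossings.**  From K2a (band exclusion) and K2b (crossing sum): for a window density `ρ`
at level `A > 0` with primitive `Φ`, a kernel `k` with `𝓕k ≡ 1` on `|w| ≤ A/2π`, a continuous
solution `h = k ⋆ fract(Φ + h)` with `⌊Φ + h⌋` monotone and `Φ + h → ±∞`, the first crossings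
`γ_j = inf {T : j ≤ Φ(T) + h(T)}` (`j ∈ ℤ`) reproduce `W` on the Weil tests supported in `[-A, A]`.
Proof: for a window test `g` put `F(T) = ĝ(1/2+iT)`, `F′ = i·(t g)^(1/2+i·)`
(`hasDerivAt_weilMellin_line`); both decay like `(1+T²)⁻²` (`stub_traceAssembly_decay_pair`);
`G = Φ + h` grows at most like `1+T²` (`stub_traceAssembly_growth`,
`stub_traceAssembly_feedback_bound`); K2b gives `HasSum_j F(γ_j) = −∫ F′⌊G⌋`, and
`−∫ F′⌊G⌋ = W(g)` by `stub_traceAssembly_value` with K2a applied to the Weil test `t ↦ t g(t)` and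
`b = fract G`. [folklore] -/
theorem stub_traceAssembly :
    (∀ (A : ℝ) (g : ℝ → ℂ) (k : 𝓢(ℝ, ℝ)) (b : ℝ → ℝ) (B : ℝ), IsWeilTest g → tsupport g ⊆ Icc (-A) A →
      (∀ w : ℝ, |w| ≤ A / (2 * π) → 𝓕 (fun T : ℝ => ((k T : ℝ) : ℂ)) w = 1) →
      Measurable b → (∀ s : ℝ, |b s| ≤ B) →
      ∫ T : ℝ, weilMellin g (1 / 2 + (T : ℂ) * I) * ((∫ s : ℝ, k (T - s) * b s : ℝ) : ℂ) =
        ∫ T : ℝ, weilMellin g (1 / 2 + (T : ℂ) * I) * ((b T : ℝ) : ℂ)) →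
    (∀ (G : ℝ → ℝ) (F F' : ℝ → ℂ) (C L : ℝ), Continuous G → Monotone (fun T : ℝ => ⌊G T⌋) →
      Tendsto G atTop atTop → Tendsto G atBot atBot → (∀ T : ℝ, |G T| ≤ L * (1 + T ^ 2)) →
      (∀ T : ℝ, HasDerivAt F (F' T) T) → Continuous F' →
      (∀ T : ℝ, ‖F T‖ ≤ C / (1 + T ^ 2) ^ 2) → (∀ T : ℝ, ‖F' T‖ ≤ C / (1 + T ^ 2) ^ 2) →
      HasSum (fun j : ℤ => F (sInf {T : ℝ | (j : ℝ) ≤ G T})) (-∫ T : ℝ, F' T * ((⌊G T⌋ : ℝ) : ℂ))) →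
    ∀ (A : ℝ) (Φ ρ h : ℝ → ℝ) (k : 𝓢(ℝ, ℝ)), 0 < A →
      (∀ g : ℝ → ℂ, IsWeilTest g → tsupport g ⊆ Icc (-A) A →
        Integrable (fun T : ℝ => weilMellin g (1 / 2 + (T : ℂ) * I) * ((ρ T : ℝ) : ℂ)) ∧
        ∫ T : ℝ, weilMellin g (1 / 2 + (T : ℂ) * I) * ((ρ T : ℝ) : ℂ) = weilFunctional g) →
      Continuous ρ → (∀ T : ℝ, HasDerivAt Φ (ρ T) T) →
      (∃ C : ℝ, ∀ T : ℝ, |ρ T| ≤ C * Real.log (2 + |T|)) →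
      (∀ w : ℝ, |w| ≤ A / (2 * π) → 𝓕 (fun T : ℝ => ((k T : ℝ) : ℂ)) w = 1) →
      Continuous h → (∀ T : ℝ, h T = ∫ s : ℝ, k (T - s) * Int.fract (Φ s + h s)) →
      Monotone (fun T : ℝ => ⌊Φ T + h T⌋) →
      Tendsto (fun T : ℝ => Φ T + h T) atTop atTop → Tendsto (fun T : ℝ => Φ T + h T) atBot atBot →
      ∃ (ι : Type) (γ : ι → ℝ), ∀ g : ℝ → ℂ, IsWeilTest g → tsupport g ⊆ Icc (-A) A →
        HasSum (fun i => weilMellin g (1 / 2 + (γ i : ℂ) * I)) (weilFunctional g) := by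
  intro h2a h2b A Φ ρ h k _hA hwin _hρc hΦ hρlog hband hhc hfeed hmono htop hbot
  obtain ⟨LΦ, hLΦ⟩ := stub_traceAssembly_growth hΦ hρlog
  have hK : ∀ T : ℝ, |h T| ≤ ∫ s : ℝ, |k s| := stub_traceAssembly_feedback_bound k hfeed
  have hK0 : 0 ≤ ∫ s : ℝ, |k s| := integral_nonneg fun s => abs_nonneg _
  have hK' : ∀ T : ℝ, |h T| ≤ (∫ s : ℝ, |k s|) * (1 + T ^ 2) := fun T =>
    (hK T).trans (le_mul_of_one_le_right hK0 (by nlinarith [sq_nonneg T]))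
  have hΦc : Continuous Φ := continuous_iff_continuousAt.2 fun T => (hΦ T).continuousAt
  refine ⟨ℤ, fun j => sInf {T : ℝ | (j : ℝ) ≤ Φ T + h T}, fun g hg hsupp => ?_⟩
  have hg₁ : IsWeilTest fun t : ℝ => (t : ℂ) * g t := isWeilTest_mul_id hg
  have hsupp₁ : tsupport (fun t : ℝ => (t : ℂ) * g t) ⊆ Icc (-A) A :=
    tsupport_mul_subset_right.trans hsupp
  obtain ⟨C, hFd, hF'd⟩ := stub_traceAssembly_decay_pair hg
  have hF'c : Continuous fun T : ℝ =>
      I * weilMellin (fun t : ℝ => (t : ℂ) * g t) (1 / 2 + (T : ℂ) * I) :=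
    continuous_const.mul ((continuous_weilMellin hg₁.1.continuous hg₁.2).comp (by fun_prop))
  have hGg : ∀ T : ℝ, |Φ T + h T| ≤ (LΦ + ∫ s : ℝ, |k s|) * (1 + T ^ 2) := fun T => by
    have := abs_add_le (Φ T) (h T)
    nlinarith [hLΦ T, hK' T]
  -- K2b: the crossing sum equals `-∫ F' ⌊G⌋`
  have hsum : HasSum
      (fun j : ℤ => weilMellin g (1 / 2 + ((sInf {T : ℝ | (j : ℝ) ≤ Φ T + h T} : ℝ) : ℂ) * I))
      (-∫ T : ℝ, I * weilMellin (fun t : ℝ => (t : ℂ) * g t) (1 / 2 + (T : ℂ) * I) *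
        ((⌊Φ T + h T⌋ : ℝ) : ℂ)) :=
    h2b (fun T => Φ T + h T) (fun T => weilMellin g (1 / 2 + (T : ℂ) * I))
      (fun T => I * weilMellin (fun t : ℝ => (t : ℂ) * g t) (1 / 2 + (T : ℂ) * I)) C
      (LΦ + ∫ s : ℝ, |k s|) (hΦc.add hhc) hmono htop hbot hGg (hasDerivAt_weilMellin_line hg) hF'c
      hFd hF'd
  -- K2a: the feedback is invisible to the window test `t ↦ t g(t)`
  have hbb : ∀ s : ℝ, |Int.fract (Φ s + h s)| ≤ 1 := fun s => by
    rw [abs_of_nonneg (Int.fract_nonneg _)]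
    exact (Int.fract_lt_one _).le
  have hex : ∫ T : ℝ, weilMellin (fun t : ℝ => (t : ℂ) * g t) (1 / 2 + (T : ℂ) * I) *
        ((∫ s : ℝ, k (T - s) * Int.fract (Φ s + h s) : ℝ) : ℂ) =
      ∫ T : ℝ, weilMellin (fun t : ℝ => (t : ℂ) * g t) (1 / 2 + (T : ℂ) * I) *
        ((Int.fract (Φ T + h T) : ℝ) : ℂ) :=
    h2a A (fun t : ℝ => (t : ℂ) * g t) k (fun T => Int.fract (Φ T + h T)) 1 hg₁ hsupp₁ hband
      (hΦc.add hhc).measurable.fract hbb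
  have hex' : ∫ T : ℝ, weilMellin (fun t : ℝ => (t : ℂ) * g t) (1 / 2 + (T : ℂ) * I) *
        ((h T : ℝ) : ℂ) =
      ∫ T : ℝ, weilMellin (fun t : ℝ => (t : ℂ) * g t) (1 / 2 + (T : ℂ) * I) *
        ((Int.fract (Φ T + h T) : ℝ) : ℂ) := by
    rw [← hex]
    refine integral_congr_ae (Eventually.of_forall fun T => ?_)
    show _ * ((h T : ℝ) : ℂ) = _
    rw [hfeed T]
  rw [stub_traceAssembly_value hg (hwin g hg hsupp) hΦ hLΦ hhc hK' hex' hFd hF'd] at hsum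
  exact hsum

end Summit.RiemannHypothesis.RiemannHypothesis.Theorems.SpectralTraceWindowStep

end
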